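import Summits.NavierStokesRegularity.NavierStokesRegularity.Theorems.RecurrentProfilesRecurrentReductionOrbit
import HarnessLib

/-!
# Crux `RecurrentLiouville` (stmt-NavierStokesRegularity-1589), line `Sketch` — stub
# `stub_rlSelfSimilarOfShrinkingOrbit`: `L³_loc` limits of fields with shrinking scaling orbits are
# a.e. scale invariant

Theorems-only file (no definitions, no named facts), pure `L³_loc` bookkeeping of the
Navier–Stokes scaling `u ↦ u_c`, `u_c(t, x) = c u(c² t, c x)` (`nsRescale c u`).  Let
`v_k → w` in `L³(Q(0, R))` for every `R > 0`, and suppose the scaling orbit of `v_k` has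
`L³(Q(0, 1))`-diameter at most `δ_k → 0`: `‖(v_k)_{e^σ} − v_k‖_{L³(Q(0,1))} ≤ δ_k` for all `σ`.
Then `w_{e^σ} = w` almost everywhere on the open backward slab `ℝ₋ × ℝ³`, for every `σ`
(`stub_rlSelfSimilarOfShrinkingOrbit`).

Proof.  (1) On `Q(0, 1)`: `‖w_c − w‖ ≤ ‖w_c − (v_k)_c‖ + ‖(v_k)_c − v_k‖ + ‖v_k − w‖` with
`c = e^σ`; the first term is `c · c^{-5/3} ‖w − v_k‖_{L³(Q(0, c))}` by the exact scaling law
(`eLpNorm_zoom_sub_zoom`), so all three terms tend to `0` and `‖w_c − w‖_{L³(Q(0,1))} = 0`.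
(2) On `Q(0, R)`: zooming by `R`, `R · R^{-5/3} ‖w_{e^σ} − w‖_{L³(Q(0,R))} =
‖w_{e^{σ + log R}} − w_{e^{log R}}‖_{L³(Q(0,1))} = 0` by (1) twice, through `w`.  (3) The slab is
exhausted by the balls `Q(0, n + 1)` (`lowerHalf_subset_iUnion_parabolicCylinder`).

## References

* J. Leray, Acta Math. 63 (1934), §20 (the scaling). [Leray1934]
* D. Albritton, T. Barker, J. Math. Fluid Mech. 21 (2019), no. 43 = arXiv:1811.00502, §3.
  [AlbrittonBarker2019]
-/

noncomputable section

-- the sub-problem namespace repeats the summit name (D-0017 layout `Summit.<S>.<P>.Theorems`)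
set_option linter.dupNamespace false

namespace Summit.NavierStokesRegularity.NavierStokesRegularity.Theorems

open MeasureTheory Set Function Filter Topology TopologicalSpace Metric
open Literature.Analysis.FluidPDE
open scoped NNReal ENNReal

/-! ### Abstract `L^p` squeeze lemmas -/

/-- If `G_k → F`, `‖G_k − H_k‖_{L^p} ≤ δ_k → 0` and `H_k → W` in `L^p`, then `‖F − W‖_{L^p} = 0`
(triangle inequality and a squeeze). [folklore] -/
private theorem rlShrinkingOrbit_eLpNorm_sub_eq_zero_of_tendsto {α E : Type*}
    {m : MeasurableSpace α} {μ : Measure α} [NormedAddCommGroup E] {p : ℝ≥0∞} (hp : 1 ≤ p)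
    {F W : α → E} {G H : ℕ → α → E} {δ : ℕ → ℝ}
    (hF : AEStronglyMeasurable F μ) (hW : AEStronglyMeasurable W μ)
    (hG : ∀ k, AEStronglyMeasurable (G k) μ) (hH : ∀ k, AEStronglyMeasurable (H k) μ)
    (h1 : Tendsto (fun k => eLpNorm (F - G k) p μ) atTop (𝓝 0))
    (h2 : ∀ k, eLpNorm (G k - H k) p μ ≤ ENNReal.ofReal (δ k)) (hδ : Tendsto δ atTop (𝓝 0))
    (h3 : Tendsto (fun k => eLpNorm (H k - W) p μ) atTop (𝓝 0)) :
    eLpNorm (F - W) p μ = 0 := by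
  have hle : ∀ k, eLpNorm (F - W) p μ ≤
      eLpNorm (F - G k) p μ + (ENNReal.ofReal (δ k) + eLpNorm (H k - W) p μ) := by
    intro k
    have e : F - W = (F - G k) + ((G k - H k) + (H k - W)) := by
      rw [sub_add_sub_cancel, sub_add_sub_cancel]
    calc eLpNorm (F - W) p μ
        ≤ eLpNorm (F - G k) p μ + eLpNorm ((G k - H k) + (H k - W)) p μ := by
          rw [e]
          exact eLpNorm_add_le (hF.sub (hG k)) (((hG k).sub (hH k)).add ((hH k).sub hW)) hp
      _ ≤ eLpNorm (F - G k) p μ + (eLpNorm (G k - H k) p μ + eLpNorm (H k - W) p μ) :=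
          add_le_add le_rfl (eLpNorm_add_le ((hG k).sub (hH k)) ((hH k).sub hW) hp)
      _ ≤ eLpNorm (F - G k) p μ + (ENNReal.ofReal (δ k) + eLpNorm (H k - W) p μ) :=
          add_le_add le_rfl (add_le_add (h2 k) le_rfl)
  have hδ' : Tendsto (fun k => ENNReal.ofReal (δ k)) atTop (𝓝 0) := by
    have h := ENNReal.tendsto_ofReal hδ
    rwa [ENNReal.ofReal_zero] at h
  have hlim := h1.add (hδ'.add h3)
  rw [add_zero, add_zero] at hlim
  exact le_antisymm (ge_of_tendsto' hlim hle) zero_le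

/-- If `‖A − W‖_{L^p} = 0` and `‖B − W‖_{L^p} = 0` then `‖A − B‖_{L^p} = 0`. [folklore] -/
private theorem rlShrinkingOrbit_eLpNorm_sub_eq_zero_of_through {α E : Type*}
    {m : MeasurableSpace α} {μ : Measure α} [NormedAddCommGroup E] {p : ℝ≥0∞} (hp : 1 ≤ p)
    {A B W : α → E} (hA : AEStronglyMeasurable A μ) (hB : AEStronglyMeasurable B μ)
    (hW : AEStronglyMeasurable W μ) (h1 : eLpNorm (A - W) p μ = 0) (h2 : eLpNorm (B - W) p μ = 0) :
    eLpNorm (A - B) p μ = 0 := by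
  refine le_antisymm ?_ zero_le
  have e : A - B = (A - W) + (W - B) := by rw [sub_add_sub_cancel]
  calc eLpNorm (A - B) p μ ≤ eLpNorm (A - W) p μ + eLpNorm (W - B) p μ := by
        rw [e]
        exact eLpNorm_add_le (hA.sub hW) (hW.sub hB) hp
    _ = 0 := by rw [h1, eLpNorm_sub_comm, h2, add_zero]

/-! ### The scaling bookkeeping -/

/-- The scaling constant `c (c⁵)^{-1/3}` is nonzero for `c > 0`. [folklore] -/
private theorem rlShrinkingOrbit_zoomConst_ne_zero {c : ℝ} (hc : 0 < c) :
    ‖c‖ₑ * (ENNReal.ofReal (c ^ 2 * c ^ 3)⁻¹) ^ (1 / (3 : ℝ≥0∞).toReal) ≠ 0 := by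
  refine mul_ne_zero ?_ ?_
  · simpa using hc.ne'
  · exact (ENNReal.rpow_pos (ENNReal.ofReal_pos.2 (by positivity)) ENNReal.ofReal_ne_top).ne'

/-- **Step 1 (the unit ball).**  If `v_k → w` in `L³(Q(0, 1))` and in `L³(Q(0, c))`, and
`‖(v_k)_c − v_k‖_{L³(Q(0,1))} ≤ δ_k → 0`, then `‖w_c − w‖_{L³(Q(0,1))} = 0`: the exact scaling law
`‖w_c − (v_k)_c‖_{L³(Q(0,1))} = c (c⁵)^{-1/3} ‖w − v_k‖_{L³(Q(0,c))}` and the triangle inequality.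
[folklore] -/
private theorem rlShrinkingOrbit_unitBall
    {v : ℕ → ℝ → EuclideanSpace ℝ (Fin 3) → EuclideanSpace ℝ (Fin 3)}
    {w : ℝ → EuclideanSpace ℝ (Fin 3) → EuclideanSpace ℝ (Fin 3)} {δ : ℕ → ℝ} {c : ℝ} (hc : 0 < c)
    (hδ : Tendsto δ atTop (𝓝 0))
    (hvm : ∀ k, AEStronglyMeasurable (uncurry (v k))
      (volume.restrict (parabolicCylinder 1 (0 : ℝ × EuclideanSpace ℝ (Fin 3)))))
    (hvcm : ∀ k, AEStronglyMeasurable (uncurry (nsRescale c (v k)))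
      (volume.restrict (parabolicCylinder 1 (0 : ℝ × EuclideanSpace ℝ (Fin 3)))))
    (hwm : AEStronglyMeasurable (uncurry w)
      (volume.restrict (parabolicCylinder 1 (0 : ℝ × EuclideanSpace ℝ (Fin 3)))))
    (hwcm : AEStronglyMeasurable (uncurry (nsRescale c w))
      (volume.restrict (parabolicCylinder 1 (0 : ℝ × EuclideanSpace ℝ (Fin 3)))))
    (hconv1 : Tendsto (fun k => eLpNorm (uncurry (v k) - uncurry w) 3
      (volume.restrict (parabolicCylinder 1 (0 : ℝ × EuclideanSpace ℝ (Fin 3))))) atTop (𝓝 0))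
    (hconvc : Tendsto (fun k => eLpNorm (uncurry (v k) - uncurry w) 3
      (volume.restrict (parabolicCylinder c (0 : ℝ × EuclideanSpace ℝ (Fin 3))))) atTop (𝓝 0))
    (hdev : ∀ k, eLpNorm (uncurry (nsRescale c (v k)) - uncurry (v k)) 3
      (volume.restrict (parabolicCylinder 1 (0 : ℝ × EuclideanSpace ℝ (Fin 3)))) ≤
        ENNReal.ofReal (δ k)) :
    eLpNorm (uncurry (nsRescale c w) - uncurry w) 3
      (volume.restrict (parabolicCylinder 1 (0 : ℝ × EuclideanSpace ℝ (Fin 3)))) = 0 := by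
  -- the first term, by the exact scaling law
  have hA : Tendsto (fun k => eLpNorm (uncurry (nsRescale c w) - uncurry (nsRescale c (v k))) 3
      (volume.restrict (parabolicCylinder 1 (0 : ℝ × EuclideanSpace ℝ (Fin 3))))) atTop (𝓝 0) := by
    have e : ∀ k, eLpNorm (uncurry (nsRescale c w) - uncurry (nsRescale c (v k))) 3
        (volume.restrict (parabolicCylinder 1 (0 : ℝ × EuclideanSpace ℝ (Fin 3)))) =
        ‖c‖ₑ * (ENNReal.ofReal (c ^ 2 * c ^ 3)⁻¹) ^ (1 / (3 : ℝ≥0∞).toReal) *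
          eLpNorm (uncurry (v k) - uncurry w) 3
            (volume.restrict (parabolicCylinder c (0 : ℝ × EuclideanSpace ℝ (Fin 3)))) := by
      intro k
      rw [nsRescale_eq_zoom, nsRescale_eq_zoom, eLpNorm_zoom_sub_zoom _ _ hc 1, mul_one,
        eLpNorm_sub_comm]
    simp_rw [e]
    have h := ENNReal.Tendsto.const_mul hconvc (Or.inr (zoomConst_ne_top c))
      (a := ‖c‖ₑ * (ENNReal.ofReal (c ^ 2 * c ^ 3)⁻¹) ^ (1 / (3 : ℝ≥0∞).toReal))
    rwa [mul_zero] at h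
  exact rlShrinkingOrbit_eLpNorm_sub_eq_zero_of_tendsto (by norm_num) hwcm hwm hvcm hvm hA hdev hδ
    hconv1

/-- **Step 2 (all balls).**  If `‖w_{e^τ} − w‖_{L³(Q(0,1))} = 0` for every `τ`, then `w_{e^σ} = w`
a.e. on `Q(0, R)` for every `R > 0`: zooming by `R`,
`R (R⁵)^{-1/3} ‖w_{e^σ} − w‖_{L³(Q(0,R))} = ‖w_{e^{σ + log R}} − w_{e^{log R}}‖_{L³(Q(0,1))} = 0`.
[folklore] -/
private theorem rlShrinkingOrbit_ball
    {w : ℝ → EuclideanSpace ℝ (Fin 3) → EuclideanSpace ℝ (Fin 3)}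
    (hwm : ∀ (c : ℝ), 0 < c → ∀ R : ℝ, 0 < R → AEStronglyMeasurable (uncurry (nsRescale c w))
      (volume.restrict (parabolicCylinder R (0 : ℝ × EuclideanSpace ℝ (Fin 3)))))
    (h1 : ∀ τ : ℝ, eLpNorm (uncurry (nsRescale (Real.exp τ) w) - uncurry w) 3
      (volume.restrict (parabolicCylinder 1 (0 : ℝ × EuclideanSpace ℝ (Fin 3)))) = 0)
    (σ : ℝ) {R : ℝ} (hR : 0 < R) :
    ∀ᵐ z ∂(volume.restrict (parabolicCylinder R (0 : ℝ × EuclideanSpace ℝ (Fin 3)))),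
      nsRescale (Real.exp σ) w z.1 z.2 = w z.1 z.2 := by
  have hwm1 : ∀ r : ℝ, 0 < r → AEStronglyMeasurable (uncurry w)
      (volume.restrict (parabolicCylinder r (0 : ℝ × EuclideanSpace ℝ (Fin 3)))) := by
    intro r hr
    have h := hwm 1 one_pos r hr
    rwa [nsRescale_one] at h
  -- through `w` on the unit ball
  have hzero : eLpNorm (uncurry (nsRescale (Real.exp (σ + Real.log R)) w) -
      uncurry (nsRescale (Real.exp (Real.log R)) w)) 3
      (volume.restrict (parabolicCylinder 1 (0 : ℝ × EuclideanSpace ℝ (Fin 3)))) = 0 :=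
    rlShrinkingOrbit_eLpNorm_sub_eq_zero_of_through (by norm_num) (hwm _ (Real.exp_pos _) 1 one_pos)
      (hwm _ (Real.exp_pos _) 1 one_pos) (hwm1 1 one_pos) (h1 _) (h1 _)
  -- zoom by `R`
  have hscale : ‖R‖ₑ * (ENNReal.ofReal (R ^ 2 * R ^ 3)⁻¹) ^ (1 / (3 : ℝ≥0∞).toReal) *
      eLpNorm (uncurry (nsRescale (Real.exp σ) w) - uncurry w) 3
        (volume.restrict (parabolicCylinder R (0 : ℝ × EuclideanSpace ℝ (Fin 3)))) = 0 := by
    have e1 : nsRescale (Real.exp (σ + Real.log R)) w = nsRescale R (nsRescale (Real.exp σ) w) := by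
      rw [Real.exp_add, Real.exp_log hR, nsRescale_mul]
    have e2 : nsRescale (Real.exp (Real.log R)) w = nsRescale R w := by
      rw [Real.exp_log hR]
    rw [e1, e2, nsRescale_eq_zoom R (nsRescale _ w), nsRescale_eq_zoom R w,
      eLpNorm_zoom_sub_zoom _ _ hR 1, mul_one] at hzero
    exact hzero
  have h0 := (mul_eq_zero.1 hscale).resolve_left (rlShrinkingOrbit_zoomConst_ne_zero hR)
  rw [eLpNorm_eq_zero_iff ((hwm _ (Real.exp_pos σ) R hR).sub (hwm1 R hR)) (by norm_num)] at h0
  filter_upwards [h0] with z hz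
  rw [Pi.sub_apply, Pi.zero_apply, sub_eq_zero] at hz
  exact hz

/-! ### The stub -/

/-- **`L³_loc` limits of fields with shrinking scaling orbits are a.e. scale invariant.**  If
`v_k → w` in `L³(Q(0, R))` for every `R > 0` and `‖(v_k)_{e^σ} − v_k‖_{L³(Q(0,1))} ≤ δ_k → 0` for
all `σ`, then for every `σ` the rescaled field `w_{e^σ}`, `w_{c}(t, x) = c w(c² t, c x)`, agrees
with `w` almost everywhere on the open backward slab `ℝ₋ × ℝ³` (unit ball by the exact scaling law
and the triangle inequality; all balls by zooming; exhaustion of the slab by `Q(0, n+1)`).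
[folklore] -/
theorem stub_rlSelfSimilarOfShrinkingOrbit :
    ∀ (v : ℕ → ℝ → EuclideanSpace ℝ (Fin 3) → EuclideanSpace ℝ (Fin 3))
      (w : ℝ → EuclideanSpace ℝ (Fin 3) → EuclideanSpace ℝ (Fin 3)) (δ : ℕ → ℝ),
      Tendsto δ atTop (𝓝 0) →
      (∀ (k : ℕ) (c : ℝ), 0 < c → ∀ R : ℝ, 0 < R → AEStronglyMeasurable (uncurry (nsRescale c (v k)))
        (volume.restrict (parabolicCylinder R (0 : ℝ × EuclideanSpace ℝ (Fin 3))))) →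
      (∀ (c : ℝ), 0 < c → ∀ R : ℝ, 0 < R → AEStronglyMeasurable (uncurry (nsRescale c w))
        (volume.restrict (parabolicCylinder R (0 : ℝ × EuclideanSpace ℝ (Fin 3))))) →
      (∀ R : ℝ, 0 < R → Tendsto (fun k => eLpNorm (uncurry (v k) - uncurry w) 3
        (volume.restrict (parabolicCylinder R (0 : ℝ × EuclideanSpace ℝ (Fin 3))))) atTop (𝓝 0)) →
      (∀ (k : ℕ) (σ : ℝ), eLpNorm (uncurry (nsRescale (Real.exp σ) (v k)) - uncurry (v k)) 3
        (volume.restrict (parabolicCylinder 1 (0 : ℝ × EuclideanSpace ℝ (Fin 3)))) ≤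
          ENNReal.ofReal (δ k)) →
      ∀ σ : ℝ, ∀ᵐ z ∂(volume.restrict (Iio (0 : ℝ) ×ˢ (univ : Set (EuclideanSpace ℝ (Fin 3))))),
        nsRescale (Real.exp σ) w z.1 z.2 = w z.1 z.2 := by
  intro v w δ hδ hvm hwm hconv hdev σ
  -- measurability of the unscaled fields (`c = 1`)
  have hwm1 : AEStronglyMeasurable (uncurry w)
      (volume.restrict (parabolicCylinder 1 (0 : ℝ × EuclideanSpace ℝ (Fin 3)))) := by
    have h := hwm 1 one_pos 1 one_pos
    rwa [nsRescale_one] at h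
  have hvm1 : ∀ k, AEStronglyMeasurable (uncurry (v k))
      (volume.restrict (parabolicCylinder 1 (0 : ℝ × EuclideanSpace ℝ (Fin 3)))) := by
    intro k
    have h := hvm k 1 one_pos 1 one_pos
    rwa [nsRescale_one] at h
  -- Step 1 at every log-scale
  have h1 : ∀ τ : ℝ, eLpNorm (uncurry (nsRescale (Real.exp τ) w) - uncurry w) 3
      (volume.restrict (parabolicCylinder 1 (0 : ℝ × EuclideanSpace ℝ (Fin 3)))) = 0 := fun τ =>
    rlShrinkingOrbit_unitBall (Real.exp_pos τ) hδ hvm1 (fun k => hvm k _ (Real.exp_pos τ) 1 one_pos)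
      hwm1 (hwm _ (Real.exp_pos τ) 1 one_pos) (hconv 1 one_pos) (hconv _ (Real.exp_pos τ))
      (fun k => hdev k τ)
  -- Steps 2–3: every ball, then the slab by exhaustion
  refine ae_restrict_of_ae_restrict_of_subset lowerHalf_subset_iUnion_parabolicCylinder ?_
  rw [ae_restrict_iUnion_iff]
  intro n
  exact rlShrinkingOrbit_ball hwm h1 σ (by positivity)

end Summit.NavierStokesRegularity.NavierStokesRegularity.Theorems
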